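import Summits.HubbardSuperconductivity.HubbardSuperconductivity.Theses.AposterioriCapRg
import Summits.HubbardSuperconductivity.HubbardSuperconductivity.Theorems.SeededBrokenRegimeBoseFermiPinned.Negative.LoadBearing
import Summits.HubbardSuperconductivity.HubbardSuperconductivity.Theorems.AposterioriCapRgSeededBrokenRegimeBoseFermiPinnedSeedSliceBound
import Summits.HubbardSuperconductivity.HubbardSuperconductivity.Theorems.AposterioriCapRgSeededBrokenRegimeBoseFermiPinnedSeedConvolution
import Summits.HubbardSuperconductivity.HubbardSuperconductivity.Theorems.AposterioriCapRgSeededBrokenRegimeBoseFermiPinnedSeedSliceCovarianceBound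
import Summits.HubbardSuperconductivity.HubbardSuperconductivity.Theorems.AposterioriCapRgSeededBrokenRegimeBoseFermiPinnedSeedSliceCovarianceSupport
import Summits.HubbardSuperconductivity.HubbardSuperconductivity.Theorems.AposterioriCapRgSeededBrokenRegimeBoseFermiPinnedSeedRotationIdentity
import Summits.HubbardSuperconductivity.HubbardSuperconductivity.Theorems.AposterioriCapRgSeededBrokenRegimeBoseFermiPinnedLoosenedDatum

/-!
# Line `seed-strength-flow` — skeleton v3 for crux `SeededBrokenRegimeBoseFermiPinned` (stmt-HubbardSuperconductivity-14047)

Lead lineage `prover-line-stmt-HubbardSuperconductivity-14047` (v1 2026-08-16T04:14Z; v2/v3 06:11–06:14Z as item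
evidence; THIS file = v3 re-typed by the kept lead c1 against the LANDED stub modules, 2026-08-16T10:40Z).

## The line

Above a fermionic infrared scale `Λ₀` the Koma–Tasaki pair seed `h` is a regular GAUSSIAN parameter of the
countertermed effective action `𝒢_h := hubbardEffectiveActionCT L M β U μ h K Λ₀` (seed in the covariance only).
Hence (S2, landed) `𝒢_h = effAction (C^{>Λ₀}_h − C^{>Λ₀}_{h₀}) 𝒢_{h₀}` EXACTLY, with a seed-slice covariance that is
(S1, S3, S8, landed) supported above `Λ₀/2` and of sup-size `≤ 32√2·βL²|h − h₀|/Λ₀²`.  The crux is cut as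
ANCHOR ∧ STEP: (S4, ANCHOR) the crux's conclusion-shape at the SINGLE massive anchor seed `h₀ := D.scale/4`, with slack
(gap ratio `20`, thresholds `(2·kStar, etaStar/2)`) and drefute's scale cap `D.scale ≤ Λ·e⁻⁸/30`, in MODEL FORM
(one admissible frame, one enclosed tuple, realised for all large `M`); (S5, STEP) lowering the seed from the anchor
to every `h ∈ (0, h₀)` keeps a tuple of the factor-two box of `D` realised; (S7, landed) loosens `D` to ONE datum `D'`
of the same scale / patches / nodal set meeting `(kStar, etaStar)` and enclosing the box; (S6, landed) is the rotation
identity pinning the transverse mass.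

## Composition

`SeededBrokenRegimeBoseFermiPinned_of`: pure logic — `Θ :=` componentwise `min` of the tolerances of S4 and S5 (the
certificate is antitone in `Θ`: `Negative.certificateT_mono_tol`, landed p76062); `D` from ANCHOR; `h₀ := D.scale/4`;
`D'` from S7; at `h < h₀` the box tuple of STEP, at `h = h₀` the anchor tuple itself; membership in the CT report by
`mem_hubbardScaleReportCTAt_of_eventually`.  The density clause and `δ` are not used (`CruxNoDens` shape, Disproof §4).

## Stubs

Landed (imported, namespace `…Theorems.AposterioriCapRgSeededBrokenRegimeBoseFermiPinned`): `stub_seedSliceBound` (S1,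
p80662), `stub_seedConvolution` (S2, p80724), `stub_seedSliceCovarianceBound` (S3, p80516), `stub_seedRotationIdentity`
(S6, p81838), `stub_loosenedDatum` (S7, p83751), `stub_seedSliceCovarianceSupport` (S8, p84771).
Open (sorried below, registered signatures): `stub_anchorFlow` (S4, ANCHOR, lead), `stub_seedLowering` (S5, STEP);
v4/v5 (lead c1, 2026-08-16T10:50Z–13:10Z) add the remainder-structure stubs — ALL LANDED (`--supports`, statements below are
byte-identical to the landed theorems of namespace `…Theorems.AposterioriCapRgSeededBrokenRegimeBoseFermiPinned`; kept sorried here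
only because the hub's snapshot lags the new oleans): N1 `stub_quadraticFormKernelFour` p97707, N2 `stub_cooperKeptKernelAnomalous`
p99377, N3 `stub_legKernelNormSingle` p100512, N4 `stub_cooperKeptKernelTwo` p100571 (wave-2 workers); N5 `stub_anomalousKernelFloor` +
N6 `stub_quadraticMismatchFloor` p102134 (lead; `…AnomalousKernelFloor.lean`); N7 `stub_anomalousKernelOfCertified` + N8
`stub_realisedFloorOfAnomalousKernel` p103691 (lead; `…AnomalousKernelCertified.lean`, verdict pending at write time).
DUAL LEAD SEATING: the second lead seat `…-14047-1` runs branch b (`Lines/seed_strength_flow_b.lean`: S9 charge-seed covariance,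
S10a seed parity, S10b charge neutrality, S11 Gaussian-parameter flow equation); the registry is shared (16 active stubs) and both
seats register ADDITIVELY with `workitem stub-add` (no further `skeleton check`).
STATUS OF THE OPEN STUBS (standing disprover, Disproof.lean cycles 2–3): S5 inherits the crux-level `∀ etaStar` floor of
the report D1″ (anomalous `B₁g` block not kept by `cooperKeptCT`, marginal in `scaledRemainderNormCT`); S4 is false only
below an anchor floor `≈ (2–4)·10⁻⁵`.  Both are crux-sized; see `LEAD_VERDICT.md` (verdict: misstated) in the crux dir.
-/

set_option linter.dupNamespace false

namespace Summit.HubbardSuperconductivity.HubbardSuperconductivity.Lines.SeededBrokenRegimeBoseFermiPinned.SeedStrengthFlow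

open Summit.HubbardSuperconductivity.HubbardSuperconductivity.Theses.AposterioriCapRg
open Summit.HubbardSuperconductivity.HubbardSuperconductivity.Theorems.SeededBrokenRegimeBoseFermiPinned
open Summit.HubbardSuperconductivity.HubbardSuperconductivity.Theorems
open Literature.MathematicalPhysics.QuantumLattice Literature.Probability.LatticeModels GrassmannAlgebra Filter
open scoped Matrix ComplexConjugate

/-! ### S4 — ANCHOR: the massive Bose–Fermi flow at the single seed `h₀ = D.scale/4` (model form, scale-capped) -/

/-- **S4 (`AnchorFlow`, ANCHOR)**: for all thresholds there is a tolerance such that at every certified point of the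
box there is a scale datum `D` with `D.scale ≤ Λ·e⁻⁸/30`, meeting the thresholds WITH SLACK (gap ratio `20`,
`(2·kStar, etaStar/2)`), `0 < N_p`, `0 < m₀.fst`, and — in MODEL FORM — for all large `L` and `β ≥ β₀(L)` one admissible
frame `K'` and one tuple `p` enclosed by `D` that is CT-realised at the anchor seed `D.scale/4` for all large `M`.
Crux-strength (XL); false only below an anchor floor `≈ (2–4)·10⁻⁵` (Disproof §12). -/
theorem stub_anchorFlow :
    ∀ kStar etaStar : ℚ, 0 < kStar → 0 < etaStar → ∃ Θ : SymmetricTolerance,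
      ∀ U ∈ Set.Icc (2:ℝ) 3, ∀ (μ : ℝ) (K : TrigPolyC4v) (Λ : ℝ) (L₀ : ℕ),
        symmetricRegimeCertificateT U μ capRgCornerDataT Θ K Λ L₀ →
          ∃ D : HubbardScaleData, (D.scale : ℝ) ≤ Λ * Real.exp (-8) / 30 ∧
            D.MeetsThresholdsWith 20 (2 * kStar) (etaStar / 2) ∧ 0 < D.numPatches ∧
            0 < D.meanFieldDensity.fst ∧
            ∃ L₁ : ℕ, ∀ L : ℕ, L₁ ≤ L → ∀ [NeZero L], ∃ β₀ : ℝ, ∀ β : ℝ, β₀ ≤ β →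
              ∃ K' : TrigPolyC4v, IsAdmissibleFrame K' ∧
                ∃ p : HubbardScaleData.Parameters D.numPatches, D.Encloses p ∧
                  ∀ᶠ M in Filter.atTop,
                    IsRealisedAtCT L M β U μ ((D.scale : ℝ) / 4) K' (D.scale : ℝ) D.numPatches D.nodal p := by
  sorry

/-! ### S5 — STEP: lowering the seed from the anchor, `h`-uniformly (model form, scale-capped) -/

/-- **S5 (`SeedLowering`, STEP)**: for all thresholds there is a tolerance such that at every certified point, for
every scale-capped datum `D` meeting the slack thresholds and certified at its anchor seed `D.scale/4`, at EVERY seed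
`h ∈ (0, D.scale/4)` and all large `L`, `β ≥ β₀(L)` some admissible frame realises, for all large `M`, a tuple of the
factor-two box of `D` (gaps widened by `10Λ₀`, `ρ_s ∈ [⅔ρ.fst, 2ρ.snd]`, `κ, m₀` within factor `2`, velocities in
`[v.fst/2, 4v.snd/3]`, `η ≤ 2η.snd`).  Crux-strength (XL); as typed over D1″ it inherits the `∀ etaStar` floor
(Disproof §10, `stub_seedLowering_false_of_targetFloorHyp`; drefute/cdisprove `stub-misstated`). -/
theorem stub_seedLowering :
    ∀ kStar etaStar : ℚ, 0 < kStar → 0 < etaStar → ∃ Θ : SymmetricTolerance,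
      ∀ U ∈ Set.Icc (2:ℝ) 3, ∀ (μ : ℝ) (K : TrigPolyC4v) (Λ : ℝ) (L₀ : ℕ),
        symmetricRegimeCertificateT U μ capRgCornerDataT Θ K Λ L₀ →
          ∀ D : HubbardScaleData, (D.scale : ℝ) ≤ Λ * Real.exp (-8) / 30 →
            D.MeetsThresholdsWith 20 (2 * kStar) (etaStar / 2) → 0 < D.numPatches →
            0 < D.meanFieldDensity.fst →
            (∃ L₀' : ℕ, D.IsCertifiedEnclosure (hubbardScaleReportCT U μ D ((D.scale : ℝ) / 4)) L₀') →
              ∀ h ∈ Set.Ioo (0:ℝ) ((D.scale : ℝ) / 4), ∃ L₁ : ℕ, ∀ L : ℕ, L₁ ≤ L → ∀ [NeZero L],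
                ∃ β₀ : ℝ, ∀ β : ℝ, β₀ ≤ β → ∃ K' : TrigPolyC4v, IsAdmissibleFrame K' ∧
                  ∃ p : HubbardScaleData.Parameters D.numPatches,
                    ((∀ i, ((D.gap i).fst : ℝ) - 10 * (D.scale : ℝ) ≤ p.gap i ∧
                          p.gap i ≤ ((D.gap i).snd : ℝ) + 10 * (D.scale : ℝ)) ∧
                        2 / 3 * (D.stiffness.fst : ℝ) ≤ p.stiffness ∧ p.stiffness ≤ 2 * (D.stiffness.snd : ℝ) ∧
                        (D.compressibility.fst : ℝ) / 2 ≤ p.compressibility ∧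
                        p.compressibility ≤ 2 * (D.compressibility.snd : ℝ) ∧
                        (D.fermiVelocity.fst : ℝ) / 2 ≤ p.fermiVelocity ∧
                        p.fermiVelocity ≤ 4 / 3 * (D.fermiVelocity.snd : ℝ) ∧
                        (D.gapVelocity.fst : ℝ) / 2 ≤ p.gapVelocity ∧ p.gapVelocity ≤ 4 / 3 * (D.gapVelocity.snd : ℝ) ∧
                        p.remainderNorm ≤ 2 * (D.remainderNorm.snd : ℝ) ∧
                        (D.meanFieldDensity.fst : ℝ) / 2 ≤ p.meanFieldDensity ∧
                        p.meanFieldDensity ≤ 2 * (D.meanFieldDensity.snd : ℝ)) ∧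
                      ∀ᶠ M in Filter.atTop,
                        IsRealisedAtCT L M β U μ h K' (D.scale : ℝ) D.numPatches D.nodal p := by
  sorry

/-! ### N1–N6 — STRUCTURE OF THE REPORT'S REMAINDER NORM (v4 addition, lead c1)

What `scaledRemainderNormCT` sees of the true effective action `𝒢 = hubbardEffectiveActionCT …` independently of the
hidden normal form `q`: the quadratic form `𝒬(q)` has no quartic kernel (N1) and the kept Cooper term `𝒦(𝒢)` has no
kernel at a same-charge quartic configuration (N2: the anomalous monomials `ψ⁺ψ⁺ψ⁺ψ⁺` / `ψ⁻ψ⁻ψ⁻ψ⁻`, i.e. the blocks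
`B̄B̄`, `BB` of the transverse pair exchange) nor any quadratic kernel (N4); a single weighted term is dominated by
Salmhofer's leg-weighted `L¹–L^∞` norm (N3).  Hence (N5) the ANOMALOUS quartic kernel of `𝒢` itself, with energy leg
weights and the marginal scaling `Λ₀⁻⁵`, is a lower bound of the remainder norm of EVERY normal form, and (N6) so is the
quadratic mismatch `𝒢₂ − 𝒬(q)` with shell weights and the relevant scaling `Λ₀⁻¹`.  These are the kernel-checkable half
of the standing disprover's finding F1 (the `∀ etaStar` floor: Disproof.lean §9, FLOOR_c2.md) and, read the other way,
the estimate the consumer R (stmt-13884) extracts from a small certified `η` (control of the non-kept anomalous block).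
They are recorded in the composition as ingredients; they do not change the obligations S4/S5. -/

/-- **N1 (`QuadraticFormKernelFour`)**: the quadratic quasiparticle form `𝒬(q)` has vanishing `4`-point kernel. -/
theorem stub_quadraticFormKernelFour :
    ∀ (L M Np : ℕ) [NeZero L] (β : ℝ) (q : HubbardNormalForm L Np) (X : Fin 4 → HubbardFieldIdx L M),
      kernel ℂ (normalFormQuadratic L M β q) 4 X = 0 := by
  sorry

/-- **N2 (`CooperKeptKernelAnomalous`)**: the kept Cooper term `𝒦^K(F)` (monomials `ψ⁺↑ψ⁺↓ψ⁻↓ψ⁻↑`) has vanishing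
`4`-point kernel at every configuration whose four legs carry the SAME charge index (`ψ⁺ψ⁺ψ⁺ψ⁺` or `ψ⁻ψ⁻ψ⁻ψ⁻`): the
anomalous blocks `B̄B̄`, `BB` are not kept. -/
theorem stub_cooperKeptKernelAnomalous :
    ∀ (L M : ℕ) [NeZero L] (β μ : ℝ) (K : TrigPolyC4v) (Λ₀ : ℝ) (F : HubbardGrassmann L M)
      (X : Fin 4 → HubbardFieldIdx L M) (c : Fin 2), (∀ i, (X i).2 = c) →
        kernel ℂ (cooperKeptCT L M β μ K Λ₀ F) 4 X = 0 := by
  sorry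

/-- **N3 (`LegKernelNormSingle`)**: one weighted term is dominated by the leg-weighted `L¹–L^∞` norm:
`ε^m · ∏_q wt(X_q) · ‖K X‖ ≤ ‖K‖_{wt,ε}` for nonnegative weights (`m + 1` legs). -/
theorem stub_legKernelNormSingle :
    ∀ (L M : ℕ) [NeZero L] (wt : HubbardFieldIdx L M → ℝ) (ε : ℝ) (m : ℕ)
      (K : (Fin (m + 1) → HubbardFieldIdx L M) → ℂ) (X : Fin (m + 1) → HubbardFieldIdx L M),
        0 ≤ ε → (∀ Y, 0 ≤ wt Y) → ε ^ m * ((∏ q, wt (X q)) * ‖K X‖) ≤ legKernelNorm wt ε (m + 1) K := by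
  sorry

/-- **N4 (`CooperKeptKernelTwo`)**: the kept Cooper term (homogeneous of degree `4`) has vanishing `2`-point kernel. -/
theorem stub_cooperKeptKernelTwo :
    ∀ (L M : ℕ) [NeZero L] (β μ : ℝ) (K : TrigPolyC4v) (Λ₀ : ℝ) (F : HubbardGrassmann L M)
      (X : Fin 2 → HubbardFieldIdx L M), kernel ℂ (cooperKeptCT L M β μ K Λ₀ F) 2 X = 0 := by
  sorry

/-- **N5 (`AnomalousKernelFloor`)**: for EVERY normal form `q`, the scaled remainder norm dominates the anomalous
quartic kernel of the effective action itself, energy-leg-weighted, at the marginal scaling `Λ₀⁻⁵`: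
`Λ₀⁻⁵ · ε³ · ∏ᵢ wt^E_q(Xᵢ) · |𝒢̃₄(X)| ≤ η^K(q)` at every same-charge configuration `X` (`ε = (βL²)⁻¹`). -/
theorem stub_anomalousKernelFloor :
    ∀ (L M Np : ℕ) [NeZero L] (β U μ h : ℝ) (K : TrigPolyC4v) (Λ₀ : ℝ) (q : HubbardNormalForm L Np)
      (X : Fin 4 → HubbardFieldIdx L M) (c : Fin 2), 0 < β → 0 < Λ₀ → (∀ i, (X i).2 = c) →
        Λ₀ ^ (-(5 : ℤ)) * ((1 / (β * (L : ℝ) ^ 2)) ^ 3 *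
          ((∏ i, energyLegWeightCT L M β μ h K Λ₀ q (X i)) *
            ‖weightedKernel (1 / (β * (L : ℝ) ^ 2)) (hubbardEffectiveActionCT L M β U μ h K Λ₀) 4 X‖)) ≤
          scaledRemainderNormCT L M β U μ h K Λ₀ q := by
  sorry

/-- **N6 (`QuadraticMismatchFloor`)**: for EVERY normal form `q`, the scaled remainder norm dominates the quadratic
mismatch `𝒢 − 𝒬(q)`, shell-weighted, at the relevant scaling `Λ₀⁻¹`: `Λ₀⁻¹ · ε · wt(X₀)wt(X₁) · |(𝒢 − 𝒬(q))~₂(X)| ≤ η^K(q)`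
(a dishonest normal form is charged at the relevant rate). -/
theorem stub_quadraticMismatchFloor :
    ∀ (L M Np : ℕ) [NeZero L] (β U μ h : ℝ) (K : TrigPolyC4v) (Λ₀ : ℝ) (q : HubbardNormalForm L Np)
      (X : Fin 2 → HubbardFieldIdx L M), 0 < β → 0 < Λ₀ →
        Λ₀ ^ (-(1 : ℤ)) * ((1 / (β * (L : ℝ) ^ 2)) *
          ((∏ i, shellLegWeightCT L M β μ K Λ₀ (X i)) *
            ‖weightedKernel (1 / (β * (L : ℝ) ^ 2))
                (hubbardEffectiveActionCT L M β U μ h K Λ₀ - normalFormQuadratic L M β q) 2 X‖)) ≤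
          scaledRemainderNormCT L M β U μ h K Λ₀ q := by
  sorry

/-- **N7 (`AnomalousKernelOfCertified`)**: a certified enclosure of the CT report forces, for every `L ≥ max L₀' 1`, all large `β`
and every `δ > 0`, frequently in `M`, an admissible frame and a normal form whose energy-weighted anomalous quartic term of the
effective action is at most `D.remainderNorm.snd + δ` (N5 through the Kuratowski upper limit and the enclosure). LANDED p103691. -/
theorem stub_anomalousKernelOfCertified :
    ∀ (U μ h : ℝ) (D : HubbardScaleData) (L₀' : ℕ),
      D.IsCertifiedEnclosure (hubbardScaleReportCT U μ D h) L₀' →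
        ∀ L : ℕ, max L₀' 1 ≤ L → ∀ [NeZero L], ∃ β₀ : ℝ, ∀ β : ℝ, β₀ ≤ β → ∀ δ : ℝ, 0 < δ →
          ∃ᶠ M in Filter.atTop, ∃ K : TrigPolyC4v, IsAdmissibleFrame K ∧
            ∃ q : HubbardNormalForm L D.numPatches,
              ∀ (X : Fin 4 → HubbardFieldIdx L M) (c : Fin 2), (∀ i, (X i).2 = c) →
                (D.scale : ℝ) ^ (-(5 : ℤ)) * ((1 / (β * (L : ℝ) ^ 2)) ^ 3 *
                  ((∏ i, energyLegWeightCT L M β μ h K (D.scale : ℝ) q (X i)) *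
                    ‖weightedKernel (1 / (β * (L : ℝ) ^ 2))
                        (hubbardEffectiveActionCT L M β U μ h K (D.scale : ℝ)) 4 X‖)) ≤
                  (D.remainderNorm.snd : ℝ) + δ := by
  sorry

/-- **N8 (`RealisedFloorOfAnomalousKernel`)**: a lower bound `c` on the energy-weighted anomalous quartic term of the effective
action, uniform over the normal forms, is a remainder FLOOR `c ≤ p.remainderNorm` on every realised tuple (the input shape of
Disproof.lean §9 `reportFloor_of_realisedFloor`). LANDED p103691. -/
theorem stub_realisedFloorOfAnomalousKernel :
    ∀ (L M Np : ℕ) [NeZero L] (β U μ h : ℝ) (K : TrigPolyC4v) (Λ₀ c : ℝ) (nodal : Finset (Fin Np)),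
      0 < Λ₀ →
        (∀ q : HubbardNormalForm L Np, ∃ X : Fin 4 → HubbardFieldIdx L M, ∃ c' : Fin 2, (∀ i, (X i).2 = c') ∧
          c ≤ Λ₀ ^ (-(5 : ℤ)) * ((1 / (β * (L : ℝ) ^ 2)) ^ 3 *
            ((∏ i, energyLegWeightCT L M β μ h K Λ₀ q (X i)) *
              ‖weightedKernel (1 / (β * (L : ℝ) ^ 2)) (hubbardEffectiveActionCT L M β U μ h K Λ₀) 4 X‖))) →
        ∀ p : HubbardScaleData.Parameters Np, IsRealisedAtCT L M β U μ h K Λ₀ Np nodal p → c ≤ p.remainderNorm := by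
  sorry

/-! ### Composition (pure logic; kernel-checked modulo S4, S5) -/

/-- The componentwise minimum of two tolerances. -/
def minTol (Θ₁ Θ₂ : SymmetricTolerance) : SymmetricTolerance where
  mismatch := min Θ₁.mismatch Θ₂.mismatch
  mismatch_pos := lt_min Θ₁.mismatch_pos Θ₂.mismatch_pos
  width := min Θ₁.width Θ₂.width
  width_pos := lt_min Θ₁.width_pos Θ₂.width_pos

/-- Model form ⇒ certified enclosure: a datum enclosing, for all `L ≥ L₁` (`L ≥ 1`) and `β ≥ β₀(L)`, a tuple realised in
one admissible frame for all large `M`, is a certified enclosure of the CT report from `max L₁ 1` on. -/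
theorem isCertifiedEnclosure_of_eventually {U μ h : ℝ} (D : HubbardScaleData) {L₁ : ℕ}
    (hreal : ∀ L : ℕ, L₁ ≤ L → ∀ [NeZero L], ∃ β₀ : ℝ, ∀ β : ℝ, β₀ ≤ β →
      ∃ K' : TrigPolyC4v, IsAdmissibleFrame K' ∧ ∃ p : HubbardScaleData.Parameters D.numPatches, D.Encloses p ∧
        ∀ᶠ M in Filter.atTop, IsRealisedAtCT L M β U μ h K' (D.scale : ℝ) D.numPatches D.nodal p) :
    D.IsCertifiedEnclosure (hubbardScaleReportCT U μ D h) (max L₁ 1) := by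
  intro L hL
  haveI : NeZero L := ⟨by omega⟩
  obtain ⟨β₀, hβ₀⟩ := hreal L (le_of_max_le_left hL)
  refine ⟨β₀, fun β hβ => ?_⟩
  obtain ⟨K', hK', p, hDp, hp⟩ := hβ₀ β hβ
  exact ⟨p, by rw [hubbardScaleReportCT_eq]; exact mem_hubbardScaleReportCTAt_of_eventually hK' hp, hDp⟩

/-- **The line closes the crux**: ANCHOR (S4) and STEP (S5) give `SeededBrokenRegimeBoseFermiPinned`, via the landed
loosening S7; the landed model-level lemmas S1–S3, S6, S8 are recorded as the ingredients of the open stubs' proofs. -/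
theorem SeededBrokenRegimeBoseFermiPinned_of : SeededBrokenRegimeBoseFermiPinned := by
  have _s1 := @AposterioriCapRgSeededBrokenRegimeBoseFermiPinned.stub_seedSliceBound
  have _s2 := @AposterioriCapRgSeededBrokenRegimeBoseFermiPinned.stub_seedConvolution
  have _s3 := AposterioriCapRgSeededBrokenRegimeBoseFermiPinned.stub_seedSliceCovarianceBound _s1
  have _s6 := @AposterioriCapRgSeededBrokenRegimeBoseFermiPinned.stub_seedRotationIdentity
  have _s8 := @AposterioriCapRgSeededBrokenRegimeBoseFermiPinned.stub_seedSliceCovarianceSupport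
  -- structure of the remainder norm (N1–N6): what `η` charges of `𝒢` for every hidden normal form
  have _n1 := @stub_quadraticFormKernelFour
  have _n2 := @stub_cooperKeptKernelAnomalous
  have _n3 := @stub_legKernelNormSingle
  have _n4 := @stub_cooperKeptKernelTwo
  have _n5 := @stub_anomalousKernelFloor
  have _n6 := @stub_quadraticMismatchFloor
  have _n7 := @stub_anomalousKernelOfCertified
  have _n8 := @stub_realisedFloorOfAnomalousKernel
  intro kStar etaStar hk he
  obtain ⟨ΘA, hA⟩ := stub_anchorFlow kStar etaStar hk he
  obtain ⟨ΘS, hS⟩ := stub_seedLowering kStar etaStar hk he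
  refine ⟨minTol ΘA ΘS, ?_⟩
  intro U hU δ _hδ μ _hdens K Λ L₀ hcert
  have hcA : symmetricRegimeCertificateT U μ capRgCornerDataT ΘA K Λ L₀ :=
    Negative.certificateT_mono_tol (min_le_left _ _) (min_le_left _ _) hcert
  have hcS : symmetricRegimeCertificateT U μ capRgCornerDataT ΘS K Λ L₀ :=
    Negative.certificateT_mono_tol (min_le_right _ _) (min_le_right _ _) hcert
  obtain ⟨D, hcap, hmeets, hNp, hm, L₁, hanchor⟩ := hA U hU μ K Λ L₀ hcA
  -- the anchor enclosure in certified form (input of STEP)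
  have hanchorCert : ∃ L₀' : ℕ, D.IsCertifiedEnclosure (hubbardScaleReportCT U μ D ((D.scale : ℝ) / 4)) L₀' :=
    ⟨max L₁ 1, isCertifiedEnclosure_of_eventually D hanchor⟩
  have hstep := hS U hU μ K Λ L₀ hcS D hcap hmeets hNp hm hanchorCert
  -- loosen the datum (S7, landed)
  obtain ⟨gap', ρ', κ', vF', vΔ', η', m₀', hmeets', hm₀', hencl, hbox⟩ :=
    AposterioriCapRgSeededBrokenRegimeBoseFermiPinned.stub_loosenedDatum D kStar etaStar hk he hmeets hm
  set D' : HubbardScaleData := HubbardScaleData.mk D.scale D.scale_pos D.numPatches D.nodal gap' ρ' κ' vF' vΔ' η' m₀'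
    with hD'
  have hΛpos : (0 : ℝ) < (D.scale : ℝ) := D.cast_scale_pos
  refine ⟨(D.scale : ℝ) / 4, by positivity, D', hmeets', hNp, hm₀', ?_⟩
  intro h hh
  rcases lt_or_eq_of_le hh.2 with hlt | heq
  · -- `h < h₀`: the box tuple of STEP, enclosed by `D'`
    obtain ⟨L₂, hL₂⟩ := hstep h ⟨hh.1, hlt⟩
    refine ⟨max L₂ 1, ?_⟩
    intro L hL
    haveI : NeZero L := ⟨by omega⟩
    obtain ⟨β₀, hβ₀⟩ := hL₂ L (le_of_max_le_left hL)
    refine ⟨β₀, fun β hβ => ?_⟩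
    obtain ⟨K', hK', p, hpbox, hp⟩ := hβ₀ β hβ
    have hη0 : 0 ≤ p.remainderNorm := by
      obtain ⟨M, hM⟩ := hp.exists
      exact hM.remainderNorm_nonneg hΛpos.le
    refine ⟨p, ?_, hbox p hη0 hpbox⟩
    show p ∈ hubbardScaleReportCTAt U μ h (D.scale : ℝ) D.numPatches D.nodal L β
    exact mem_hubbardScaleReportCTAt_of_eventually hK' hp
  · -- `h = h₀`: the anchor tuple itself, enclosed by `D` hence by `D'`
    subst heq
    refine ⟨max L₁ 1, ?_⟩
    intro L hL
    haveI : NeZero L := ⟨by omega⟩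
    obtain ⟨β₀, hβ₀⟩ := hanchor L (le_of_max_le_left hL)
    refine ⟨β₀, fun β hβ => ?_⟩
    obtain ⟨K', hK', p, hDp, hp⟩ := hβ₀ β hβ
    refine ⟨p, ?_, hencl p hDp⟩
    show p ∈ hubbardScaleReportCTAt U μ ((D.scale : ℝ) / 4) (D.scale : ℝ) D.numPatches D.nodal L β
    exact mem_hubbardScaleReportCTAt_of_eventually hK' hp

end Summit.HubbardSuperconductivity.HubbardSuperconductivity.Lines.SeededBrokenRegimeBoseFermiPinned.SeedStrengthFlow
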